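import Summits.RiemannHypothesis.RiemannHypothesis.Theorems.TiltedLandingLaw421E3Cell

/-! # TiltedLandingLaw421E3ExitPace
W-07 E3 §I PATH CUT — the Z-EXIT METER and the TENT-LOCAL CHILD (C4 rh-idea-6 g22, `sectionI` rev 7 as in `InjectionPace-rev7-slim-W07c15pre-C4-rh-idea-6-g22.lean` 512097 B;
README `pub/ideators/rh-idea-6/g22/w07c15pre/README-sectionI.md`): only the declarations on the path to `exitMeter` / `exitMeter_tent_le_meterMax` (§I.7), `TentChild` /
`tentChildFamily` (§I.8), `RootChoice` / `entrantCensus` (§I.5 c9-shape), `exitMeterL` / `lineageLawG_pace_exitMeterL` / `e3CellS_exitPace_of_rest` / `descentSigS'_of_exitPace` (§I.9),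
with their in-section prerequisites (`TargetFamily`, `tentFamily`, `companions_finite`, `ChildFamily`, `UniqueChild`, `IsAncestry`, `ancestry_end_unique`, `NodeFamily`,
`EntrantFamily`, `RootedChildFamily`, `LineageExitsBefore`, `exitSet` …). The per-level UPPER route (§I.1–§I.6: `DescentInjectionG`, `LossChainsG`, `ParentWalkG`, `GapChild`, deficit) is NOT in this
module (off the cumulative route of record; landable later). DEDUP: C4's restated `tentAt_le_meterMax` (= M11 `RhW07.C14.Classes.tentAt_le_tentMeterMax`,
token-identical statement) is DELETED here and its one use cites the landed M11 name (gate `dedup.landed` lesson p746829).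
SUPPORT module for crux `TiltedLandingLaw421` (stmt-RiemannHypothesis-24774), `--supports` only: proves no stub, no crux; fully proved (no `sorry`).
Cut by tenure rh-tenure-earlyapp-1 g4 per director (CA261)(C2) from the authors' farm-checked sections (decl blocks byte-verbatim; section `/-! -/` prose and
`#print axioms` lines dropped, mechanical docstrings added where absent); K = kernel-checked lemmas about MODEL sockets (combs), not ζ/Ξ. RH is not proved. -/

namespace RhIdea6.G22.W07C15pre.Injection

open Complex
open RhIdea6.G17.W07C7 RhIdea6.G17.W07C7.Rev6 RhIdea6.G18.W07C8.Law421BirthS RhIdea6.G19.W07C11.Seam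
open RhIdea6.G20.W07C12.Frac RhIdea6.G20.W07C12.StColP RhW07.C12.FieldSplit RhIdea6.G20.W07C13pre.Tent RhIdea6.G21.W07C13.TentMax
open RhW07.C13.Heredity RhW07.C14.TwoSided RhW07.C14.Classes RhW07.C14.Lineage

/-- a TARGET FAMILY: (datum, root) ↦ the set of level-0 zeros that injected levels may consume. -/
abbrev TargetFamily : Type := ℝ → (ℂ → ℂ) → ℝ → ℝ → ℝ → ℝ → ℝ → ℕ → ℂ → Set ℂ

/-- the RAW TENT family: the companions of the root at level 0 within slope `ρ` (pair excluded). -/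
def tentFamily (ρ : ℝ) : TargetFamily := fun _η f _x₀ _s _hmax _R _Hs _B u₀ => tentSet ρ f 0 u₀

/-- (K) the companion set of an entire `g ≢ 0` whose zeros lie in the band `|Im| ≤ Hs` is FINITE. -/
theorem companions_finite {g : ℂ → ℂ} (hd : Differentiable ℂ g) (hne : g ≠ 0) {Hs : ℝ} (hband : ∀ w : ℂ, g w = 0 → |w.im| ≤ Hs)
    (c r : ℝ) (u : ℂ) : (companions g c r u).Finite :=
  (strip_zeros_finite hd hne hband c r).subset fun _ hz => ⟨hz.1, hz.2.1⟩

/-- (K) its cardinality is at most the multiplicity count `tentCount` (every zero of `g ≢ 0` has order `≥ 1`). -/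
theorem card_companions_le_tentCount {g : ℂ → ℂ} (hd : Differentiable ℂ g) (hne : g ≠ 0) {c r : ℝ} {u : ℂ}
    (hT : (companions g c r u).Finite) : (hT.toFinset.card : ℝ) ≤ tentCount g c r u := by
  rw [tentCount_eq_finsum_companions, finsum_mem_eq_finite_toFinset_sum _ hT]
  have h1 : (hT.toFinset.card : ℝ) = ∑ _z ∈ hT.toFinset, (1 : ℝ) := by simp
  rw [h1]
  exact Finset.sum_le_sum fun z hz => one_le_orderToNat_of_zero hd hne ((Set.Finite.mem_toFinset hT).mp hz).1

/-- (K) hence every finite set of companions has at most `tentCount` elements. -/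
theorem card_le_tentCount_of_subset {g : ℂ → ℂ} (hd : Differentiable ℂ g) (hne : g ≠ 0) {c r : ℝ} {u : ℂ}
    (hfin : (companions g c r u).Finite) {T : Finset ℂ} (hT : (↑T : Set ℂ) ⊆ companions g c r u) : (T.card : ℝ) ≤ tentCount g c r u := by
  have h1 : T.card ≤ hfin.toFinset.card := Finset.card_le_card (Set.Finite.subset_toFinset.mpr hT)
  have h2 : (T.card : ℝ) ≤ (hfin.toFinset.card : ℝ) := by exact_mod_cast h1
  exact h2.trans (card_companions_le_tentCount hd hne hfin)

/-- a level-indexed CHILD RELATION on zeros of successive derivatives, per datum: `Ch … m z z'` — «`z'` (a zero of `f⁽ᵐ⁺¹⁾`) descends from `z` (a zero of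
`f⁽ᵐ⁾`)» (instance: the Rolle zero in the hull gap adjacent to `z`; M9 `exists_real_zero_iteratedDeriv_succ` is existence per gap). -/
abbrev ChildFamily : Type := ℝ → (ℂ → ℂ) → ℝ → ℝ → ℝ → ℝ → ℝ → ℕ → ℕ → ℂ → ℂ → Prop

/-- UNIQUE CHILD: every node has at most one child (Laguerre «exactly one zero of f⁽ᵐ⁺¹⁾ per gap» — the OPEN uniqueness half; research, not claimed). -/
def UniqueChild (Ch : ℕ → ℂ → ℂ → Prop) : Prop := ∀ (m : ℕ) (z z₁ z₂ : ℂ), Ch m z z₁ → Ch m z z₂ → z₁ = z₂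

/-- an ANCESTRY from level `i` to level `m` along children: `c (n+1)` is a child of `c n` for `i ≤ n < m`. -/
def IsAncestry (Ch : ℕ → ℂ → ℂ → Prop) (i m : ℕ) (c : ℕ → ℂ) : Prop :=
  ∀ n : ℕ, i ≤ n → n < m → Ch n (c n) (c (n + 1))

/-- (K) under unique child, two ancestries from the SAME node at level `i` that both end childless end at the same level. -/
theorem ancestry_end_unique {Ch : ℕ → ℂ → ℂ → Prop} (hU : UniqueChild Ch) {i j j' : ℕ} {c c' : ℕ → ℂ} (hij : i ≤ j) (hij' : i ≤ j')
    (hc : IsAncestry Ch i j c) (hc' : IsAncestry Ch i j' c') (hend : ∀ z' : ℂ, ¬ Ch j (c j) z') (hend' : ∀ z' : ℂ, ¬ Ch j' (c' j') z')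
    (h0 : c i = c' i) : j = j' := by
  have hagree : ∀ n : ℕ, i ≤ n → n ≤ j → n ≤ j' → c n = c' n := by
    intro n hin
    induction n, hin using Nat.le_induction with
    | base => exact fun _ _ => h0
    | succ n hin ih =>
      intro hn hn'
      have h1 : Ch n (c n) (c (n + 1)) := hc n hin (Nat.lt_of_succ_le hn)
      have h2 : Ch n (c' n) (c' (n + 1)) := hc' n hin (Nat.lt_of_succ_le hn')
      rw [ih (Nat.le_of_succ_le hn) (Nat.le_of_succ_le hn')] at h1
      exact hU n _ _ _ h1 h2
  by_contra hne
  rcases Nat.lt_or_gt_of_ne hne with hlt | hgt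
  · have h := hc' j hij hlt
    rw [← hagree j hij le_rfl hlt.le] at h
    exact hend _ h
  · have h := hc j' hij' hgt
    rw [hagree j' hij' hgt.le le_rfl] at h
    exact hend' _ h

/-- a NODE FAMILY: (datum, root `u₀`, level `m`) ↦ the tracked nodes at level `m` (instance: the tent zeros of f⁽ᵐ⁾ of the lineage rooted at `u₀`). -/
abbrev NodeFamily : Type := ℝ → (ℂ → ℂ) → ℝ → ℝ → ℝ → ℝ → ℝ → ℕ → ℂ → ℕ → Set ℂ

/-- an ENTRANT FAMILY: (datum, root, level) ↦ the finite set of ENTRANTS at that level (tracked nodes with no tracked parent). -/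
abbrev EntrantFamily : Type := ℝ → (ℂ → ℂ) → ℝ → ℝ → ℝ → ℝ → ℝ → ℕ → ℂ → ℕ → Finset ℂ

/-- a ROOTED CHILD FAMILY: the child relation may be read relative to the lineage's root `u₀` (e.g. «least gap zero inside the tracked tent»). -/
abbrev RootedChildFamily : Type := ℝ → (ℂ → ℂ) → ℝ → ℝ → ℝ → ℝ → ℝ → ℕ → ℂ → ℕ → ℂ → ℂ → Prop

/-- a ROOT CHOICE: datum ↦ the canonical level-0 lowest state u₀ of the lineage (instance work: e.g. a `Classical.choose` of a lowest state). -/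
abbrev RootChoice : Type := ℝ → (ℂ → ℂ) → ℝ → ℝ → ℝ → ℝ → ℝ → ℕ → ℂ

/-- the **ENTRANT CENSUS** of the instance data `(E, root)` as a LEVEL METER: `k ↦ Σ_{i<k} #E datum (root datum) i` — a TYPED prefix functional of the
trajectory once `N, E, root` are definitions (critic c9 l.5345 / C1 ACK-3 l.5349 / C2 RIDER-33 l.5343: σ := S named, never ∃, never a free parameter). -/
def entrantCensus (E : EntrantFamily) (root : RootChoice) : LevelMeter := fun η f x₀ s hmax R Hs B k =>
  ∑ i ∈ Finset.range k, ((E η f x₀ s hmax R Hs B (root η f x₀ s hmax R Hs B) i).card : ℝ)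

/-- the lineage of `z` from level 0 under `Ch` ENDS (reaches a childless node) at some level `< k`. -/
def LineageExitsBefore (Ch : ℕ → ℂ → ℂ → Prop) (z : ℂ) (k : ℕ) : Prop :=
  ∃ m : ℕ, m < k ∧ ∃ c : ℕ → ℂ, c 0 = z ∧ IsAncestry Ch 0 m c ∧ ∀ z' : ℂ, ¬ Ch m (c m) z'

/-- the Z-EXIT SET below level `k`. -/
def exitSet (Ch : ℕ → ℂ → ℂ → Prop) (Z : Set ℂ) (k : ℕ) : Set ℂ := {z : ℂ | z ∈ Z ∧ LineageExitsBefore Ch z k}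

/-- W-07 E3 support (E03 §I, C4 rh-idea-6 g22): see the module docstring and the source README. -/
theorem exitSet_subset (Ch : ℕ → ℂ → ℂ → Prop) (Z : Set ℂ) (k : ℕ) : exitSet Ch Z k ⊆ Z := fun _ hz => hz.1

/-- W-07 E3 support (E03 §I, C4 rh-idea-6 g22): see the module docstring and the source README. -/
theorem exitSet_mono (Ch : ℕ → ℂ → ℂ → Prop) (Z : Set ℂ) {k k' : ℕ} (hk : k ≤ k') : exitSet Ch Z k ⊆ exitSet Ch Z k' :=
  fun _ ⟨hz, m, hm, c, h0, hc, he⟩ => ⟨hz, m, lt_of_lt_of_le hm hk, c, h0, hc, he⟩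

/-- (K) under UNIQUE CHILD the exit level of a member is unique (`ancestry_end_unique` at i = 0). -/
theorem exitLevel_unique {Ch : ℕ → ℂ → ℂ → Prop} (hU : UniqueChild Ch) {z : ℂ} {m m' : ℕ} {c c' : ℕ → ℂ}
    (h0 : c 0 = z) (hc : IsAncestry Ch 0 m c) (he : ∀ z' : ℂ, ¬ Ch m (c m) z')
    (h0' : c' 0 = z) (hc' : IsAncestry Ch 0 m' c') (he' : ∀ z' : ℂ, ¬ Ch m' (c' m') z') : m = m' :=
  ancestry_end_unique hU (Nat.zero_le m) (Nat.zero_le m') hc hc' he he' (h0.trans h0'.symm)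

/-- the **Z-EXIT METER** `D_Z`: datum, `k` ↦ `#`(members of `Z` at the canonical root whose lineage has ended below `k`) (`Set.ncard`; finite sets only
are meant — over the raw tent the set is finite under the engine hypotheses). -/
noncomputable def exitMeter (Ch : RootedChildFamily) (Z : TargetFamily) (root : RootChoice) : LevelMeter := fun η f x₀ s hmax R Hs B k =>
  ((exitSet (Ch η f x₀ s hmax R Hs B (root η f x₀ s hmax R Hs B)) (Z η f x₀ s hmax R Hs B (root η f x₀ s hmax R Hs B)) k).ncard : ℝ)

/-- W-07 E3 support (E03 §I, C4 rh-idea-6 g22): see the module docstring and the source README. -/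
theorem exitMeter_nonneg (Ch : RootedChildFamily) (Z : TargetFamily) (root : RootChoice) (η : ℝ) (f : ℂ → ℂ) (x₀ s hmax R Hs : ℝ) (B k : ℕ) :
    0 ≤ exitMeter Ch Z root η f x₀ s hmax R Hs B k := Nat.cast_nonneg _

/-- ★ (K) **OVER THE RAW TENT AT A LOWEST ROOT THE EXIT METER IS BOUNDED BY THE SEALED LEVEL-0 METER**: `D_Z … k ≤ tentMeterMax ρ … 0` — the hypothesis
«D ≤ M 0» of C1's `lineageLawG_pace` / `e3CellS_pace_of_rest` (TYPING-8 §E4) for `D :=` the Z-exit meter of any rooted child family. -/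
theorem exitMeter_tent_le_meterMax (Ch : RootedChildFamily) (ρ : ℝ) {root : RootChoice} {η : ℝ} {f : ℂ → ℂ} {x₀ s hmax R Hs : ℝ} {B : ℕ}
    (hE : EngineHyps5 2 η f x₀ s hmax R Hs B) (hroot : IsLowest StCol' η f x₀ s hmax R Hs B 0 (root η f x₀ s hmax R Hs B)) (k : ℕ) :
    exitMeter Ch (tentFamily ρ) root η f x₀ s hmax R Hs B k ≤ tentMeterMax ρ η f x₀ s hmax R Hs B 0 := by
  set u₀ : ℂ := root η f x₀ s hmax R Hs B with hu₀
  show ((exitSet (Ch η f x₀ s hmax R Hs B u₀) (tentSet ρ f 0 u₀) k).ncard : ℝ) ≤ tentMeterMax ρ η f x₀ s hmax R Hs B 0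
  have hd0 : Differentiable ℂ (iteratedDeriv 0 f) := by rw [iteratedDeriv_zero]; exact hE.1
  have hband0 : ∀ w : ℂ, iteratedDeriv 0 f w = 0 → |w.im| ≤ Hs := by
    intro w hw; rw [iteratedDeriv_zero] at hw; exact hE.2.2.2.2.2.2.2.2.1 w hw
  have hne0 : iteratedDeriv 0 f ≠ 0 := hroot.1.1
  have hfin : (tentSet ρ f 0 u₀).Finite := companions_finite hd0 hne0 hband0 _ _ _
  have hsub : exitSet (Ch η f x₀ s hmax R Hs B u₀) (tentSet ρ f 0 u₀) k ⊆ tentSet ρ f 0 u₀ := exitSet_subset _ _ _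
  have hfinE : (exitSet (Ch η f x₀ s hmax R Hs B u₀) (tentSet ρ f 0 u₀) k).Finite := hfin.subset hsub
  have hT : (↑hfinE.toFinset : Set ℂ) ⊆ tentSet ρ f 0 u₀ :=
    fun z hz => hsub ((Set.Finite.mem_toFinset hfinE).mp (Finset.mem_coe.mp hz))
  rw [Set.ncard_eq_toFinset_card _ hfinE]
  calc (hfinE.toFinset.card : ℝ) ≤ tentAt ρ f 0 u₀ := card_le_tentCount_of_subset hd0 hne0 hfin hT
    _ ≤ tentMeterMax ρ η f x₀ s hmax R Hs B 0 := tentAt_le_tentMeterMax hE ρ hroot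

/-- the **TENT-LOCAL CHILD** relation of a node structure `N : ℕ → Set ℂ`. -/
def TentChild (N : ℕ → Set ℂ) (m : ℕ) (z z' : ℂ) : Prop :=
  z ∈ N m ∧ (∃ w ∈ N m, z.re < w.re) ∧ z' ∈ N (m + 1) ∧ z'.im = 0 ∧ z.re < z'.re ∧
    (∀ w ∈ N m, z.re < w.re → z'.re < w.re) ∧ (∀ w' ∈ N (m + 1), w'.im = 0 → z.re < w'.re → z'.re ≤ w'.re)

/-- ★ (K) (U) FOR FREE. -/
theorem uniqueChild_tentChild (N : ℕ → Set ℂ) : UniqueChild (TentChild N) := fun _ _ z₁ z₂ h1 h2 =>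
  Complex.ext
    (le_antisymm (h1.2.2.2.2.2.2 z₂ h2.2.2.1 h2.2.2.2.1 h2.2.2.2.2.1) (h2.2.2.2.2.2.2 z₁ h1.2.2.1 h1.2.2.2.1 h1.2.2.2.2.1))
    (by rw [h1.2.2.2.1, h2.2.2.2.1])

/-- ★ (K) (L) FOR FREE: a finite non-empty tracked level has a CHILDLESS node (its right-most). -/
theorem exists_childless_tentChild {N : ℕ → Set ℂ} {m : ℕ} (hfin : (N m).Finite) (hne : (N m).Nonempty) :
    ∃ z ∈ N m, ∀ z' : ℂ, ¬ TentChild N m z z' := by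
  obtain ⟨z, hz, hmax⟩ := hfin.toFinset.exists_max_image Complex.re ((Set.Finite.toFinset_nonempty hfin).mpr hne)
  refine ⟨z, (Set.Finite.mem_toFinset hfin).mp hz, fun z' h => ?_⟩
  obtain ⟨w, hw, hzw⟩ := h.2.1
  exact absurd (hmax w ((Set.Finite.mem_toFinset hfin).mpr hw)) (not_le.mpr hzw)

/-- (K, definitional) under the tent-local relation a tracked node with a tracked right neighbour is CHILDLESS iff NO real tracked level-(m+1) member lies
in its gap — «the gap zero left the tent» IS the exit (C6 (6)). -/
theorem tentChild_childless_iff {N : ℕ → Set ℂ} {m : ℕ} {z : ℂ} (hz : z ∈ N m) (hright : ∃ w ∈ N m, z.re < w.re)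
    (hfin : {w' : ℂ | w' ∈ N (m + 1) ∧ w'.im = 0 ∧ z.re < w'.re ∧ ∀ w ∈ N m, z.re < w.re → w'.re < w.re}.Finite) :
    (∀ z' : ℂ, ¬ TentChild N m z z') ↔ ∀ w' ∈ N (m + 1), w'.im = 0 → z.re < w'.re → ∃ w ∈ N m, z.re < w.re ∧ w.re ≤ w'.re := by
  constructor
  · intro hno w' hw' hw'i hw'r
    by_contra hcon
    push Not at hcon
    -- the gap members form a finite non-empty set; its least element is a child
    have hmemg : w' ∈ {w' : ℂ | w' ∈ N (m + 1) ∧ w'.im = 0 ∧ z.re < w'.re ∧ ∀ w ∈ N m, z.re < w.re → w'.re < w.re} :=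
      ⟨hw', hw'i, hw'r, fun w hw hzw => hcon w hw hzw⟩
    obtain ⟨z₀, hz₀, hmin⟩ := hfin.toFinset.exists_min_image Complex.re ((Set.Finite.toFinset_nonempty hfin).mpr ⟨w', hmemg⟩)
    have hz₀' := (Set.Finite.mem_toFinset hfin).mp hz₀
    refine hno z₀ ⟨hz, hright, hz₀'.1, hz₀'.2.1, hz₀'.2.2.1, hz₀'.2.2.2, fun w'' hw'' hw''i hw''r => ?_⟩
    by_cases hgap : ∀ w ∈ N m, z.re < w.re → w''.re < w.re
    · exact hmin w'' ((Set.Finite.mem_toFinset hfin).mpr ⟨hw'', hw''i, hw''r, hgap⟩)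
    · push Not at hgap
      obtain ⟨w, hw, hzw, hle⟩ := hgap
      exact ((hz₀'.2.2.2 w hw hzw).le.trans hle)
  · intro hcov z' h
    obtain ⟨w, hw, hzw, hle⟩ := hcov z' h.2.2.1 h.2.2.2.1 h.2.2.2.2.1
    exact absurd (h.2.2.2.2.2.1 w hw hzw) (not_lt.mpr hle)

/-- the tent-local child FAMILY of a node family. -/
def tentChildFamily (N : NodeFamily) : RootedChildFamily := fun η f x₀ s hmax R Hs B u₀ m z z' => TentChild (N η f x₀ s hmax R Hs B u₀) m z z'

section ExitPace

open RhW07.E3.Cell RhW07.C14.Booking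

open Classical in
/-- the Z-exit meter made TOTAL in the root choice: the exit count when the root is a lowest level-0 `StCol'` state, `0` otherwise. -/
noncomputable def exitMeterL (Ch : RootedChildFamily) (Z : TargetFamily) (root : RootChoice) : LevelMeter := fun η f x₀ s hmax R Hs B k =>
  if IsLowest StCol' η f x₀ s hmax R Hs B 0 (root η f x₀ s hmax R Hs B) then exitMeter Ch Z root η f x₀ s hmax R Hs B k else 0

/-- ★ (K) «D ≤ M 0» for every datum: `exitMeterL Ch (tentFamily ρ) root … k ≤ tentMeterMax ρ … 0` under the engine hypotheses. -/
theorem exitMeterL_tent_le_meterMax (Ch : RootedChildFamily) (ρ : ℝ) (root : RootChoice) :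
    ∀ (η : ℝ) (f : ℂ → ℂ) (x₀ s hmax R Hs : ℝ) (B : ℕ), EngineHyps5 2 η f x₀ s hmax R Hs B →
      ∀ k : ℕ, exitMeterL Ch (tentFamily ρ) root η f x₀ s hmax R Hs B k ≤ tentMeterMax ρ η f x₀ s hmax R Hs B 0 := by
  intro η f x₀ s hmax R Hs B hE k
  unfold exitMeterL
  split_ifs with h
  · exact exitMeter_tent_le_meterMax Ch ρ hE h k
  · exact tentMeterMax_nonneg ρ η f x₀ s hmax R Hs B 0

/-- ★★ (K) **LAW IS AUTOMATIC under the instance of record**: for every priced/tracked/ready triple, every 𝓔, every rooted child family and root choice,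
`LineageLawG P St Ready 𝓔 (paceMeter P St Ready 𝓔 (exitMeterL Ch (tentFamily ρ) root)) (tentMeterMax ρ)`. -/
theorem lineageLawG_pace_exitMeterL (P St Ready : StatePred) (𝓔 : LevelClass) (Ch : RootedChildFamily) (ρ : ℝ) (root : RootChoice) :
    LineageLawG P St Ready 𝓔 (paceMeter P St Ready 𝓔 (exitMeterL Ch (tentFamily ρ) root)) (tentMeterMax ρ) :=
  lineageLawG_pace (exitMeterL_tent_le_meterMax Ch ρ root)

/-- ★★ (K) the (CA255) cell with `S := paceMeter … D_Z` IS ITS REST HALF: REST at any 𝓔₂ ⊇ EMPTY(3/2) ⇒ `E3CellS (paceMeter … (exitMeterL Ch (tentFamily (3/2)) root))`. -/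
theorem e3CellS_exitPace_of_rest {𝓔₂ : LevelClass} (Ch : RootedChildFamily) (root : RootChoice)
    (h₂ : ∀ η f x₀ s hmax R Hs B j, EmptyClass (3 / 2) η f x₀ s hmax R Hs B j → 𝓔₂ η f x₀ s hmax R Hs B j)
    (hR : RestBudget PSealC4 𝓔₂ (paceMeter PSealC4 StCol' (CumReady WindowReady) (EmptyClass (3 / 2)) (exitMeterL Ch (tentFamily (3 / 2)) root))
      (slackBudget 1 (tentMeterMax (3 / 2))) (tentMeterMax (3 / 2))) :
    E3CellS (paceMeter PSealC4 StCol' (CumReady WindowReady) (EmptyClass (3 / 2)) (exitMeterL Ch (tentFamily (3 / 2)) root)) :=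
  e3CellS_pace_of_rest h₂ (exitMeterL_tent_le_meterMax Ch (3 / 2) root) hR

/-- (K) … and the node: REST(paceMeter D_Z) ∧ (α-low) ⇒ `DescentSigS'`. -/
theorem descentSigS'_of_exitPace {𝓔₂ : LevelClass} (Ch : RootedChildFamily) (root : RootChoice)
    (h₂ : ∀ η f x₀ s hmax R Hs B j, EmptyClass (3 / 2) η f x₀ s hmax R Hs B j → 𝓔₂ η f x₀ s hmax R Hs B j)
    (hR : RestBudget PSealC4 𝓔₂ (paceMeter PSealC4 StCol' (CumReady WindowReady) (EmptyClass (3 / 2)) (exitMeterL Ch (tentFamily (3 / 2)) root))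
      (slackBudget 1 (tentMeterMax (3 / 2))) (tentMeterMax (3 / 2)))
    (hα : IsolatedPairDropLow PSealC4) : DescentSigS' :=
  descentSigS'_of_pace h₂ (exitMeterL_tent_le_meterMax Ch (3 / 2) root) hR hα
end ExitPace

end RhIdea6.G22.W07C15pre.Injection
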